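import Summits.AtomisticToContinuum.FouriersLaw.Theorems.BondHeatUncertaintyExtensiveSnapshotIrreversibilityEnergyWindowCostateComponentsA
import HarnessLib

/-!
# Energy window — (R) CostateComponents — part 2 of 2 (sequel of `…BondHeatUncertaintyExtensiveSnapshotIrreversibilityEnergyWindowCostateComponentsA`)

Split for the 400-line cap by the landing lane (hand-2 g32); the module docstring of part 1 (`…BondHeatUncertaintyExtensiveSnapshotIrreversibilityEnergyWindowCostateComponentsA`) describes the whole node.  Same namespace; all FQNs unchanged.
0 sorry; standard axioms.
-/


namespace Summit.AtomisticToContinuum.FouriersLaw.Theorems.ExtensiveSnapshotIrreversibility.EnergyWindow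

open MeasureTheory Filter Topology Set Finset
open scoped Nat
open Literature.MathematicalPhysics.KineticTheory.HeatConduction Literature.Probability.Process

section Costate

variable {ω₂ lam β γ : ℝ} {N : ℕ} {T_L T_R : ℝ}

/-! ## 4. The `L²` bound of `α̈_j` in budget currency -/

/-- **`∫₀ˢ α̈_j² ≤ 2 N² ((1+2γ)² Λ² + C_D² (2/θ²) Θ_θ) S²`** for a path costate with `‖c‖ ≤ S` on
`[0, s] ⊆ [0, 1]` and a Hessian sup bound `Λ` along the path on `[0, s]`.
[NEW · rung (C2g) beneath (COF)] -/
theorem IsPathCostate.intervalIntegral_alphaDDot_sq_le (hω : 0 < ω₂) (hl : 0 ≤ lam) (hβ : 0 ≤ β)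
    (hγ : 0 ≤ γ) {θ : ℝ} (hθ : 0 < θ) {s : ℝ} (hs0 : 0 ≤ s) (hs1 : s ≤ 1) {z : PhaseSpace N}
    {wp : WienerPair} {c : ℝ → PhaseSpace N} (hc : IsPathCostate ω₂ lam β γ N T_L T_R s z wp c)
    {S Λ : ℝ} (hS : ∀ t ∈ Icc 0 s, ‖c t‖ ≤ S)
    (hΛ : ∀ t ∈ Icc 0 s, ∀ i j, |(pinnedChain ω₂ lam β γ).hessPotential N i j
      ((pinnedChain ω₂ lam β γ).solMap N T_L T_R t z (pairPath wp)).1| ≤ Λ) (j : Fin N) :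
    ∫ r in (0 : ℝ)..s, (∑ i, ((-(c r).1 i + γ * OscillatorChain.bathWeight N i * (c r).2 i) *
          (pinnedChain ω₂ lam β γ).hessPotential N i j
            ((pinnedChain ω₂ lam β γ).solMap N T_L T_R r z (pairPath wp)).1 +
        (c r).2 i * hessDot lam β N i j
          ((pinnedChain ω₂ lam β γ).solMap N T_L T_R r z (pairPath wp)).1
          ((pinnedChain ω₂ lam β γ).solMap N T_L T_R r z (pairPath wp)).2)) ^ 2 ≤
      2 * ((N : ℝ) * N) * ((1 + 2 * γ) ^ 2 * Λ ^ 2 +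
        (6 * lam * (1 + 1 / ω₂) + (N : ℝ) * N * (24 * β)) ^ 2 * ((2 : ℝ) / θ ^ 2) *
          energyBudget ω₂ lam β γ N T_L T_R θ z wp) * S ^ 2 := by
  set P := pinnedChain ω₂ lam β γ with hP
  set ζ : ℝ → PhaseSpace N := fun t => P.solMap N T_L T_R t z (pairPath wp) with hζ
  set CD := 6 * lam * (1 + 1 / ω₂) + (N : ℝ) * N * (24 * β) with hCD
  set Θ := energyBudget ω₂ lam β γ N T_L T_R θ z wp with hΘ
  have hζc : Continuous ζ := pinnedChain_continuous_solMap hω hl hβ hγ N T_L T_R z (pairPath wp)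
  have hHc : ∀ i, Continuous fun t => P.hessPotential N i j (ζ t).1 := fun i =>
    (continuous_hessPotential_pinned (ω₂ := ω₂) (lam := lam) (β := β) (γ := γ) N i j).comp
      (continuous_fst.comp hζc)
  have hDc : ∀ i, Continuous fun t => hessDot lam β N i j (ζ t).1 (ζ t).2 := fun i =>
    (continuous_hessDot lam β N i j).comp hζc
  -- the dominating integrand `g(r) = S² · N · Σ_i 2((1+2γ)² Hess² + hessDot²)`, continuous
  set g : ℝ → ℝ := fun t => S ^ 2 * ((N : ℝ) * ∑ i, (2 * ((1 + 2 * γ) ^ 2 *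
      (P.hessPotential N i j (ζ t).1) ^ 2) + 2 * (hessDot lam β N i j (ζ t).1 (ζ t).2) ^ 2))
    with hg
  have hgc : Continuous g :=
    continuous_const.mul (continuous_const.mul (continuous_finsetSum _ fun i _ =>
      (continuous_const.mul (continuous_const.mul ((hHc i).pow 2))).add
        (continuous_const.mul ((hDc i).pow 2))))
  -- pointwise domination on `[0, s]`
  have hpt : ∀ r ∈ Icc 0 s, (∑ i, ((-(c r).1 i + γ * OscillatorChain.bathWeight N i * (c r).2 i) *
          P.hessPotential N i j (ζ r).1 + (c r).2 i * hessDot lam β N i j (ζ r).1 (ζ r).2)) ^ 2 ≤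
        g r := by
    intro r hr
    have h1 := abs_alphaDDot_le (ω₂ := ω₂) (lam := lam) (β := β) hγ (ζ r) (c r) j
    set u : Fin N → ℝ := fun i => (1 + 2 * γ) * |P.hessPotential N i j (ζ r).1| +
      |hessDot lam β N i j (ζ r).1 (ζ r).2| with hu
    have hu0 : 0 ≤ ∑ i, u i := Finset.sum_nonneg fun i _ => by positivity
    have hsq : (∑ i, ((-(c r).1 i + γ * OscillatorChain.bathWeight N i * (c r).2 i) *
          P.hessPotential N i j (ζ r).1 + (c r).2 i * hessDot lam β N i j (ζ r).1 (ζ r).2)) ^ 2 ≤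
        (‖c r‖ * ∑ i, u i) ^ 2 := by
      have h2 := pow_le_pow_left₀ (abs_nonneg _) h1 2
      rwa [sq_abs] at h2
    have hcs : (∑ i, u i) ^ 2 ≤ (N : ℝ) * ∑ i, u i ^ 2 := by
      have h := sq_sum_le_card_mul_sum_sq (s := Finset.univ) (f := u)
      simpa only [Finset.card_univ, Fintype.card_fin] using h
    have hui : ∀ i, u i ^ 2 ≤ 2 * ((1 + 2 * γ) ^ 2 * (P.hessPotential N i j (ζ r).1) ^ 2) +
        2 * (hessDot lam β N i j (ζ r).1 (ζ r).2) ^ 2 := by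
      intro i
      have e : u i ^ 2 ≤ 2 * ((1 + 2 * γ) * |P.hessPotential N i j (ζ r).1|) ^ 2 +
          2 * |hessDot lam β N i j (ζ r).1 (ζ r).2| ^ 2 := by
        rw [hu]
        nlinarith [sq_nonneg ((1 + 2 * γ) * |P.hessPotential N i j (ζ r).1| -
          |hessDot lam β N i j (ζ r).1 (ζ r).2|)]
      calc u i ^ 2 ≤ _ := e
        _ = _ := by rw [mul_pow, sq_abs, sq_abs]
    have hS' := hS r hr
    have hc0 : 0 ≤ ‖c r‖ := norm_nonneg _
    calc _ ≤ (‖c r‖ * ∑ i, u i) ^ 2 := hsq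
      _ = ‖c r‖ ^ 2 * (∑ i, u i) ^ 2 := by ring
      _ ≤ S ^ 2 * ((N : ℝ) * ∑ i, u i ^ 2) := by
          gcongr
      _ ≤ g r := by
          rw [hg]
          exact mul_le_mul_of_nonneg_left
            (mul_le_mul_of_nonneg_left (Finset.sum_le_sum fun i _ => hui i) (Nat.cast_nonneg N))
            (sq_nonneg S)
  -- continuity of the integrand on `[0, s]`
  have hcc : ContinuousOn c (Icc 0 s) := hc.1
  have hIc : ContinuousOn (fun r => (∑ i, ((-(c r).1 i + γ * OscillatorChain.bathWeight N i * (c r).2 i) *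
          P.hessPotential N i j (ζ r).1 + (c r).2 i * hessDot lam β N i j (ζ r).1 (ζ r).2)) ^ 2)
      (Icc 0 s) := by
    refine ContinuousOn.pow (continuousOn_finsetSum _ fun i _ => ?_) 2
    have hα : ContinuousOn (fun r => (c r).1 i) (Icc 0 s) :=
      ((continuous_apply i).comp continuous_fst).comp_continuousOn hcc
    have hβ' : ContinuousOn (fun r => (c r).2 i) (Icc 0 s) :=
      ((continuous_apply i).comp continuous_snd).comp_continuousOn hcc
    exact ((hα.neg.add (continuousOn_const.mul hβ')).mul (hHc i).continuousOn).add
      (hβ'.mul (hDc i).continuousOn)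
  -- integrate the domination and pay each term
  have iA : ∀ i, IntervalIntegrable (fun t => 2 * ((1 + 2 * γ) ^ 2 *
      (P.hessPotential N i j (ζ t).1) ^ 2)) volume 0 s := fun i =>
    (continuous_const.mul (continuous_const.mul ((hHc i).pow 2))).intervalIntegrable _ _
  have iB : ∀ i, IntervalIntegrable (fun t => 2 * (hessDot lam β N i j (ζ t).1 (ζ t).2) ^ 2)
      volume 0 s := fun i => (continuous_const.mul ((hDc i).pow 2)).intervalIntegrable _ _
  have iF : ∀ i ∈ (Finset.univ : Finset (Fin N)), IntervalIntegrable (fun t =>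
      2 * ((1 + 2 * γ) ^ 2 * (P.hessPotential N i j (ζ t).1) ^ 2) +
        2 * (hessDot lam β N i j (ζ t).1 (ζ t).2) ^ 2) volume 0 s := fun i _ => (iA i).add (iB i)
  have hint : ∫ r in (0 : ℝ)..s, g r = S ^ 2 * ((N : ℝ) * ∑ i, (2 * ((1 + 2 * γ) ^ 2 *
      ∫ r in (0 : ℝ)..s, (P.hessPotential N i j (ζ r).1) ^ 2) +
        2 * ∫ r in (0 : ℝ)..s, (hessDot lam β N i j (ζ r).1 (ζ r).2) ^ 2)) := by
    rw [hg, intervalIntegral.integral_const_mul, intervalIntegral.integral_const_mul,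
      intervalIntegral.integral_finsetSum iF]
    congr 2
    refine Finset.sum_congr rfl fun i _ => ?_
    rw [intervalIntegral.integral_add (iA i) (iB i), intervalIntegral.integral_const_mul,
      intervalIntegral.integral_const_mul, intervalIntegral.integral_const_mul]
  have hH2 : ∀ i, ∫ r in (0 : ℝ)..s, (P.hessPotential N i j (ζ r).1) ^ 2 ≤ Λ ^ 2 := by
    intro i
    have hp : ∀ r ∈ Icc 0 s, (P.hessPotential N i j (ζ r).1) ^ 2 ≤ Λ ^ 2 := fun r hr => by
      have h := hΛ r hr i j
      have h2 := pow_le_pow_left₀ (abs_nonneg _) h 2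
      rwa [sq_abs] at h2
    calc ∫ r in (0 : ℝ)..s, (P.hessPotential N i j (ζ r).1) ^ 2 ≤ ∫ r in (0 : ℝ)..s, Λ ^ 2 :=
          intervalIntegral.integral_mono_on hs0 (((hHc i).pow 2).intervalIntegrable _ _)
            intervalIntegrable_const hp
      _ = s * Λ ^ 2 := by rw [intervalIntegral.integral_const, smul_eq_mul, sub_zero]
      _ ≤ 1 * Λ ^ 2 := mul_le_mul_of_nonneg_right hs1 (sq_nonneg Λ)
      _ = Λ ^ 2 := one_mul _
  have hD2 : ∀ i, ∫ r in (0 : ℝ)..s, (hessDot lam β N i j (ζ r).1 (ζ r).2) ^ 2 ≤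
      CD ^ 2 * ((2 : ℝ) / θ ^ 2) * Θ := fun i =>
    intervalIntegral_hessDot_sq_le hω hl hβ hγ N T_L T_R hθ i j z wp le_rfl hs0 hs1
  have hΘ0 : 0 ≤ Θ := (zero_le_one.trans (one_le_energyBudget (T_L := T_L) (T_R := T_R)
    hω hl hβ hγ hθ.le z wp))
  calc _ ≤ ∫ r in (0 : ℝ)..s, g r :=
        intervalIntegral.integral_mono_on hs0 (hIc.intervalIntegrable_of_Icc hs0)
          (hgc.intervalIntegrable _ _) hpt
    _ = _ := hint
    _ ≤ S ^ 2 * ((N : ℝ) * ∑ i : Fin N, (2 * ((1 + 2 * γ) ^ 2 * Λ ^ 2) +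
        2 * (CD ^ 2 * ((2 : ℝ) / θ ^ 2) * Θ))) := by
        gcongr with i _
        · exact hH2 i
        · exact hD2 i
    _ = 2 * ((N : ℝ) * N) * ((1 + 2 * γ) ^ 2 * Λ ^ 2 + CD ^ 2 * ((2 : ℝ) / θ ^ 2) * Θ) * S ^ 2 := by
        simp only [Finset.sum_const, Finset.card_univ, Fintype.card_fin, nsmul_eq_mul]; ring

/-! ## 5. Moduli of continuity of the coordinates -/

/-- **`β_i` is `(1+2γ)S`-Lipschitz on `[0, s]`.** [folklore] -/
theorem IsPathCostate.abs_snd_sub_le (hγ : 0 ≤ γ) {s : ℝ} {z : PhaseSpace N} {wp : WienerPair}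
    {c : ℝ → PhaseSpace N} (hc : IsPathCostate ω₂ lam β γ N T_L T_R s z wp c) {S : ℝ}
    (hS : ∀ t ∈ Icc 0 s, ‖c t‖ ≤ S) (i : Fin N) {x y : ℝ} (hx : x ∈ Icc 0 s)
    (hy : y ∈ Icc 0 s) :
    |(c x).2 i - (c y).2 i| ≤ (1 + 2 * γ) * S * |x - y| := by
  have hcont : ContinuousOn (fun t => (c t).2 i) (Icc 0 s) :=
    ((continuous_apply i).comp continuous_snd).comp_continuousOn hc.1
  refine abs_sub_le_mul_abs_sub_of_deriv hcont (fun r hr => hc.hasDerivAt_snd_apply hr i)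
    (fun r hr => ?_) hx hy
  exact (abs_coDrift_snd_le hγ (c r) i).trans
    (mul_le_mul_of_nonneg_left (hS r (Ioo_subset_Icc_self hr)) (by positivity))

/-- **`β̇_i` is `(NΛ + 2γ(1+2γ))S`-Lipschitz on `[0, s]`** (given a Hessian sup bound `Λ` on
`[0, s]`). [folklore] -/
theorem IsPathCostate.abs_betaDot_sub_le (hγ : 0 ≤ γ) {s : ℝ} {z : PhaseSpace N}
    {wp : WienerPair} {c : ℝ → PhaseSpace N} (hc : IsPathCostate ω₂ lam β γ N T_L T_R s z wp c)
    {S Λ : ℝ} (hS : ∀ t ∈ Icc 0 s, ‖c t‖ ≤ S) (hΛ0 : 0 ≤ Λ)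
    (hΛ : ∀ t ∈ Icc 0 s, ∀ i j, |(pinnedChain ω₂ lam β γ).hessPotential N i j
      ((pinnedChain ω₂ lam β γ).solMap N T_L T_R t z (pairPath wp)).1| ≤ Λ)
    (i : Fin N) {x y : ℝ} (hx : x ∈ Icc 0 s) (hy : y ∈ Icc 0 s) :
    |(-(c x).1 i + γ * OscillatorChain.bathWeight N i * (c x).2 i) -
        (-(c y).1 i + γ * OscillatorChain.bathWeight N i * (c y).2 i)| ≤
      ((N : ℝ) * Λ + 2 * γ * (1 + 2 * γ)) * S * |x - y| := by
  have hcont : ContinuousOn (fun t => -(c t).1 i + γ * OscillatorChain.bathWeight N i * (c t).2 i) (Icc 0 s) :=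
    (((continuous_apply i).comp continuous_fst).comp_continuousOn hc.1).neg.add
      (continuousOn_const.mul (((continuous_apply i).comp continuous_snd).comp_continuousOn hc.1))
  refine abs_sub_le_mul_abs_sub_of_deriv hcont (fun r hr => hc.hasDerivAt_betaDot hr i)
    (fun r hr => ?_) hx hy
  have hr' : r ∈ Icc 0 s := Ioo_subset_Icc_self hr
  exact (abs_betaDDot_le hγ (hΛ r hr') (c r) i).trans
    (mul_le_mul_of_nonneg_left (hS r hr') (by positivity))

/-- **`α̇_j` is Hölder-½ with constant `√(∫₀ˢ α̈_j²)`** on `[0, s]` (part N (C2c)); with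
`IsPathCostate.intervalIntegral_alphaDDot_sq_le` the constant is `O_θ(S (Λ + Θ_θ^{1/2}))`.
[NEW · rung (C2g) beneath (COF)] -/
theorem IsPathCostate.abs_alphaDot_sub_le (hω : 0 < ω₂) (hl : 0 ≤ lam) (hβ : 0 ≤ β)
    (hγ : 0 ≤ γ) {s : ℝ} {z : PhaseSpace N} {wp : WienerPair} {c : ℝ → PhaseSpace N}
    (hc : IsPathCostate ω₂ lam β γ N T_L T_R s z wp c) (j : Fin N) {x y : ℝ} (hx : x ∈ Icc 0 s)
    (hy : y ∈ Icc 0 s) :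
    |(∑ i, (c x).2 i * (pinnedChain ω₂ lam β γ).hessPotential N i j
          ((pinnedChain ω₂ lam β γ).solMap N T_L T_R x z (pairPath wp)).1) -
        (∑ i, (c y).2 i * (pinnedChain ω₂ lam β γ).hessPotential N i j
          ((pinnedChain ω₂ lam β γ).solMap N T_L T_R y z (pairPath wp)).1)| ≤
      √(∫ r in (0 : ℝ)..s, (∑ i, ((-(c r).1 i + γ * OscillatorChain.bathWeight N i * (c r).2 i) *
          (pinnedChain ω₂ lam β γ).hessPotential N i j
            ((pinnedChain ω₂ lam β γ).solMap N T_L T_R r z (pairPath wp)).1 +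
        (c r).2 i * hessDot lam β N i j
          ((pinnedChain ω₂ lam β γ).solMap N T_L T_R r z (pairPath wp)).1
          ((pinnedChain ω₂ lam β γ).solMap N T_L T_R r z (pairPath wp)).2)) ^ 2) *
        √|x - y| := by
  set P := pinnedChain ω₂ lam β γ with hP
  set ζ : ℝ → PhaseSpace N := fun t => P.solMap N T_L T_R t z (pairPath wp) with hζ
  have hζc : Continuous ζ := pinnedChain_continuous_solMap hω hl hβ hγ N T_L T_R z (pairPath wp)
  have hHc : ∀ i, Continuous fun t => P.hessPotential N i j (ζ t).1 := fun i =>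
    (continuous_hessPotential_pinned (ω₂ := ω₂) (lam := lam) (β := β) (γ := γ) N i j).comp
      (continuous_fst.comp hζc)
  have hDc : ∀ i, Continuous fun t => hessDot lam β N i j (ζ t).1 (ζ t).2 := fun i =>
    (continuous_hessDot lam β N i j).comp hζc
  have hα : ∀ i, ContinuousOn (fun r => (c r).1 i) (Icc 0 s) := fun i =>
    ((continuous_apply i).comp continuous_fst).comp_continuousOn hc.1
  have hβ' : ∀ i, ContinuousOn (fun r => (c r).2 i) (Icc 0 s) := fun i =>
    ((continuous_apply i).comp continuous_snd).comp_continuousOn hc.1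
  have hGc : ContinuousOn (fun t => ∑ i, (c t).2 i * P.hessPotential N i j (ζ t).1) (Icc 0 s) :=
    continuousOn_finsetSum _ fun i _ => (hβ' i).mul (hHc i).continuousOn
  have hhc : ContinuousOn (fun r => ∑ i, ((-(c r).1 i + γ * OscillatorChain.bathWeight N i * (c r).2 i) *
        P.hessPotential N i j (ζ r).1 + (c r).2 i * hessDot lam β N i j (ζ r).1 (ζ r).2))
      (Icc 0 s) :=
    continuousOn_finsetSum _ fun i _ =>
      (((hα i).neg.add (continuousOn_const.mul (hβ' i))).mul (hHc i).continuousOn).add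
        ((hβ' i).mul (hDc i).continuousOn)
  exact abs_sub_le_sqrt_integral_sq_mul_sqrt hGc
    (fun r hr => hc.hasDerivAt_alphaDot hω hl hβ hγ hr j) hhc hx hy

end Costate

end Summit.AtomisticToContinuum.FouriersLaw.Theorems.ExtensiveSnapshotIrreversibility.EnergyWindow
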